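import Summits.BirchSwinnertonDyer.Rank1Residual.X11b.MaxUnramifiedRestriction
import Literature.NumberTheory.GaloisRepresentations.LocalGlobalCohomologyProofs
import Literature.NumberTheory.GaloisRepresentations.DecompositionGroupOfCompletion
import Literature.NumberTheory.EllipticCurves.KummerSelmerStructure
import HarnessLib

/-!
# A global class is LOCALLY unramified at almost every place (Milne I Lemma 4.8, local form)

For a number field `K`, a discrete `Γ_K`-module `M` and `c ∈ H¹(K, M)`: for all but finitely many
finite places `v`, the localisation `loc_v c ∈ H¹(K_v, M)` lies in the unramified subgroup
`H¹_ur(K_v, M) = ker (H¹(K_v, M) → H¹(K_v^{ur}, M))` of the LOCAL module `M|_{Γ_{K_v}}`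
(`eventually_localization_mem_unramifiedSubgroup`).  The tree's named fact
`localization_eq_zero_cofinite` (proved, `localization_eq_zero_cofinite_holds`) says the same for the
GLOBAL inertia groups `I_𝔓 ≤ Γ_K`; here the statement is transported to the completion through
`I_{𝔓_v} = res(I_{K_v})` (`inertia_adicCompletionPrime_eq_map_absInertia`, Neukirch II (9.6)) and the
local criterion `[φ] ∈ H¹_ur ⟺ φ` principal on `I_{K_v}` (`LocBridge.mem_unramifiedSubgroup_one_iff_exists`).
Proof: a continuous crossed homomorphism `f` vanishes on `Gal(K̄/E)` for a finite Galois `E/K`; at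
every `v` with `I_𝔓 ≤ Gal(K̄/E)` for all `𝔓 ∣ v` (cofinitely many, `eventually_forall_inertia_mem_fixingSubgroup`)
`f ∘ res` vanishes on `I_{K_v}`.  Used by the dévissage of Milne I Thm. 4.10(b)
(`KolyvaginRoadThreePTDevissage*`).  Theorems only.

References: [MilneADT2006] I §4 Lemma 4.8; [NeukirchANT1999] II §9 Prop. (9.6).
-/

noncomputable section

open CategoryTheory Function NumberField IsDedekindDomain
open scoped NumberField

universe u

set_option linter.dupNamespace false
set_option autoImplicit false

namespace Summit.BirchSwinnertonDyer.BirchSwinnertonDyer.Theorems.KolyvaginRoadThreePT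

open Field Filter
open Literature.NumberTheory.GaloisRepresentations
open Literature.NumberTheory.GaloisRepresentations.DiscreteGaloisModule (unramifiedSubgroup)
open _root_.TopRep _root_.ContinuousCohomology
open Summit.BirchSwinnertonDyer.Rank1Residual.X11b.LocBridge

variable {K : Type u} [Field K] [NumberField K] {M : Type u} [AddCommGroup M] [TopologicalSpace M]
  [DiscreteTopology M]

/-- **`loc_v c ∈ H¹_ur(K_v, M)` whenever the cocycle vanishes on every inertia group above `v`.**
For a continuous crossed homomorphism `f : Γ_K → M` vanishing on `I_𝔓` for the prime `𝔓 = 𝔓_v` of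
`K̄` cut out by the completion, the localisation of `[f]` at `v` is unramified: `f ∘ res` vanishes on
the local inertia group `I_{K_v}`, whose image is `I_𝔓` (Neukirch II (9.6)).
[cite: NeukirchANT1999, Ch. II §9 Prop. (9.6)] [cite: MilneADT2006, Ch. I §4, Lemma 4.8] -/
theorem localization_mem_unramifiedSubgroup_of_forall_inertia (ρ : DiscreteGaloisModule K M)
    (f : contOneCocycles ρ.toTopRep) (v : HeightOneSpectrum (𝓞 K))
    (hf : ∀ g ∈ (adicCompletionPrime K v).inertia (absoluteGaloisGroup K), f.1 g = 0) :
    galoisCohomology.localization ρ (Sum.inr v) 1 (oneCocycleClass ρ.toTopRep f) ∈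
      unramifiedSubgroup (GaloisRep.toLocal v ρ) 1 := by
  -- unramified classes of the local module: principal on the local inertia group
  have key : ∀ φ' : contOneCocycles (DiscreteGaloisModule.toTopRep (GaloisRep.toLocal v ρ)),
      (∀ τ, φ'.1 τ = f.1 (absGaloisRestrict K (v.adicCompletion K) τ)) →
      oneCocycleClass _ φ' ∈ unramifiedSubgroup (GaloisRep.toLocal v ρ) 1 := by
    intro φ' hφ'
    rw [mem_unramifiedSubgroup_one_iff_exists]
    refine ⟨0, fun τ hτ => ?_⟩
    rw [hφ', map_zero, sub_zero]
    apply hf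
    rw [inertia_adicCompletionPrime_eq_map_absInertia]
    exact Subgroup.mem_map_of_mem _ hτ
  have h1 : galoisCohomology.localization ρ (Sum.inr v) 1 (oneCocycleClass ρ.toTopRep f) =
      oneCocycleClass (DiscreteGaloisModule.toTopRep (GaloisRep.toLocal v ρ))
        (contOneCocycles.pullback (absGaloisRestrict K (v.adicCompletion K))
          (X := ρ.toTopRep) (Y := DiscreteGaloisModule.toTopRep (GaloisRep.toLocal v ρ))
          (TopRep.ofHom ⟨ContinuousLinearMap.id ℤ M, fun _ => rfl⟩) f) :=
    galoisCohomology.res_one_oneCocycleClass (v.adicCompletion K) f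
  rw [h1]
  exact key _ fun τ => rfl

/-- **Milne I Lemma 4.8, local form: a global class is locally unramified at almost every place.**
For `c ∈ H¹(K, M)` (`K` a number field, `M` a discrete `Γ_K`-module), for all but finitely many
finite places `v` the localisation `loc_v c` lies in `H¹_ur(K_v, M)` (the unramified subgroup of the
local module `GaloisRep.toLocal v ρ`).  [cite: MilneADT2006, Ch. I §4, Lemma 4.8] -/
theorem eventually_localization_mem_unramifiedSubgroup (ρ : DiscreteGaloisModule K M)
    (c : galoisCohomology ρ 1) :
    ∀ᶠ v : HeightOneSpectrum (𝓞 K) in cofinite,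
      galoisCohomology.localization ρ (Sum.inr v) 1 c ∈ unramifiedSubgroup (GaloisRep.toLocal v ρ) 1 := by
  classical
  obtain ⟨f, rfl⟩ := oneCocycleClass_surjective ρ.toTopRep c
  -- the zero locus of the cocycle is a neighbourhood of `1`
  have hV : {γ : absoluteGaloisGroup K | f.1 γ = 0} ∈ nhds (1 : absoluteGaloisGroup K) := by
    refine IsOpen.mem_nhds ?_ ?_
    · exact (isOpen_discrete ({0} : Set M)).preimage f.1.continuous
    · exact contOneCocycles.apply_one f
  -- a finite normal subextension `E/K` with `f = 0` on `Gal(K̄/E)`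
  obtain ⟨E, hEfin, hEnormal, hEV⟩ :=
    (krullTopology_mem_nhds_one_iff_of_normal K (AlgebraicClosure K) _).1 hV
  haveI := hEfin
  haveI := hEnormal
  haveI : IsGalois K E := IsGalois.mk
  -- at almost all `v`, every inertia group above `v` fixes `E`
  filter_upwards [eventually_forall_inertia_mem_fixingSubgroup (F := K) E] with v hv
  refine localization_mem_unramifiedSubgroup_of_forall_inertia ρ f v fun g hg => ?_
  exact hEV (hv _ (adicCompletionPrime_mem_primesAbove K v) g hg)

/-- **Finite-set form**: for `c ∈ H¹(K, M)` there is a finite set `T` of finite places outside which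
`loc_v c` is unramified. [cite: MilneADT2006, Ch. I §4, Lemma 4.8] -/
theorem exists_finset_localization_mem_unramifiedSubgroup (ρ : DiscreteGaloisModule K M)
    (c : galoisCohomology ρ 1) :
    ∃ T : Finset (HeightOneSpectrum (𝓞 K)), ∀ v ∉ T,
      galoisCohomology.localization ρ (Sum.inr v) 1 c ∈ unramifiedSubgroup (GaloisRep.toLocal v ρ) 1 := by
  have h := eventually_localization_mem_unramifiedSubgroup ρ c
  rw [Filter.eventually_cofinite] at h
  refine ⟨h.toFinset, fun v hv => ?_⟩
  by_contra hc
  exact hv (h.mem_toFinset.2 hc)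

end Summit.BirchSwinnertonDyer.BirchSwinnertonDyer.Theorems.KolyvaginRoadThreePT

end
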